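import Summits.AtomisticToContinuum.HydrodynamicLimit.Theorems.AntiMazurCoboundariesCorrectorPressureDecayKiferEntropyBoundCore
import Summits.AtomisticToContinuum.HydrodynamicLimit.Theorems.AntiMazurCoboundariesCorrectorPressureDecayKiferEntropyBound
import Summits.AtomisticToContinuum.HydrodynamicLimit.Theorems.AntiMazurCoboundariesCorrectorPressureDecayTangentTightness

/-!
# Entropy bound for tangent states, III: the affinity reduction to the unit weight (line `FirstLemma`, crux stmt-AtomisticToContinuum-14135)

Helper file of the registered stub `stub_tangentEntropyBound : TangentEntropyBound` (F2 of `…KiferTangentEntropyDebt.lean`),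
namespace `Summit.AtomisticToContinuum.HydrodynamicLimit.Theorems.KiferCompactification`. The local-limit form
`TangentEntropyBoundLocal` of F2 (file `…KiferEntropyBound.lean`, weight `0 ≤ φ ≤ 1`, constant `(∫φ)⁻¹ σ³`) is REDUCED to its
unit-weight case `TangentEntropyBoundUniform` (posited here; constant `σ³`) and the two landed Kallenberg facts
`HardCoreLawsVaguelyCompact`, `LaplaceFunctionalDeterminesLaw` (`Literature/MathematicalPhysics/KineticTheory/PointProcessVagueCompactness.lean`):

`stub_tangentEntropyBoundLocalOfUniform : HardCoreLawsVaguelyCompact → LaplaceFunctionalDeterminesLaw →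
  TangentEntropyBoundUniform → TangentEntropyBoundLocal` (PROVED).

Proof: pass to a subsequence realising the `liminf` of the entropies (`exists_strictMono_tendsto_liminf`); along it take a
uniform-weight tangent state `μ¹` (`TangentTightness`, from the facts by `stub_tangentTightnessOfFacts`) and, if `∫φ < 1`, a
tangent state `ν` of the complementary weight `1 - φ`; since `tangentLaplace` is affine in the weight
(`tangentLaplace_one_eq_add`), `L_{μ¹} = (∫φ) L_{μ^φ} + (1 - ∫φ) L_ν` on `C_c⁺`, hence `μ¹ = (∫φ) μ^φ + (1 - ∫φ) ν` by
Laplace-functional uniqueness; the unit-weight bound gives `h(μ¹ | G) ≤ σ³ ℓ`, and the lower half of affinity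
(`stub_specificRelEntropyMixture`: `(∫φ) h(μ^φ | G) ≤ h(μ¹ | G)`) gives `h(μ^φ | G) ≤ (∫φ)⁻¹ σ³ ℓ`. This explains the factor
`(∫φ)⁻¹` of F2 exactly (domination `φ ≤ 1` plus affinity) and leaves the uniform statement as the whole entropy debt.
-/

noncomputable section

open MeasureTheory ProbabilityTheory Set Filter Topology InformationTheory
open scoped ENNReal NNReal

namespace Summit.AtomisticToContinuum.HydrodynamicLimit.Theorems.KiferCompactification

open Literature.MathematicalPhysics.KineticTheory (T3 V3 hsDiameter localGibbsLaw blowUpPoint blowUp)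
open Literature.MathematicalPhysics.KineticTheory.PointProcess (laplaceFunctional specificRelEntropy windowLaw
  HardCoreLawsVaguelyCompact LaplaceFunctionalDeterminesLaw)
open Literature.Analysis.FluidPDE (HardSphereFlow Config IsTranslationInvariant)
open Literature.Analysis.FunctionSpaces (PointConfig)

/-- **F2 IN LOCAL-LIMIT FORM FOR THE UNIT WEIGHT** (posited; the residual entropy debt of line `FirstLemma` after this
file): there is `σ₂ > 0` such that for `0 < σ < σ₂`, every tangent family `(N, Φ, Q)` with budget `κ`, every
translation-invariant probability tangent state `μ` along `ι` of the UNIFORMLY averaged blow-ups (weight `φ ≡ 1`), and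
every translation-invariant probability law `G` which is the setwise local limit along `ι` of the x-averaged blown-up
canonical laws `G_{N(ι k)}`: `specificRelEntropy μ G ≤ σ³ · liminf_k (N(ι k)+1)⁻¹ KL(Q(ι k) ‖ G_{N(ι k)})` — the textbook
form "an entropy bound `H(Q_N | G_N) ≤ C N` passes to local-equilibrium limit points with constant `1`" (Olla–Varadhan–Yau
1993 Lemma 4.2 for the Poisson reference; Kipnis–Landim 1999 for lattice canonical measures; lower semicontinuity via
Donsker–Varadhan, convexity in the base point, tiling, approximate super-additivity over macroscopic cells for the canonical
hard-sphere reference at low density). Debt, not claimed; no Gibbs structure or uniqueness involved. -/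
def TangentEntropyBoundUniform : Prop :=
  ∃ σ₂ : ℝ, 0 < σ₂ ∧
  ∀ (σ a θ : ℝ) (u₀ : V3) (κ : ℝ), 0 < σ → σ < σ₂ → 0 < a → 0 < θ → 0 < κ →
  ∀ (N : ℕ → ℕ)
    (Φ : ∀ k, HardSphereFlow (Literature.Analysis.FluidPDE.Torus.geometry (Fin 3)) (hsDiameter σ (N k)) (N k + 1))
    (Q : ∀ k, Measure (Config (N k + 1) (Fin 3) T3)),
    IsTangentFamily σ a θ u₀ κ N Φ Q →
    ∀ (ι : ℕ → ℕ) (μ : Measure (PointConfig (V3 × V3))), IsTangentState σ (fun _ => (1 : ℝ)) N Q ι μ →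
      IsProbabilityMeasure μ → IsTranslationInvariant μ →
    ∀ (G : Measure (PointConfig (V3 × V3))), IsProbabilityMeasure G → IsTranslationInvariant G →
      (∀ Λ : Set V3, MeasurableSet Λ → Bornology.IsBounded Λ → ∀ A : Set (PointConfig (V3 × V3)), MeasurableSet A →
        Tendsto (fun k => Literature.MathematicalPhysics.KineticTheory.PointProcess.windowLaw Λ
            (((volume : Measure T3).prod
              (localGibbsLaw σ (fun _ => a) (fun _ => u₀) (fun _ => θ) (N (ι k)) (Φ (ι k)))).map
              (fun p => blowUp (hsDiameter σ (N (ι k))) p.1 p.2)) A)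
          atTop (𝓝 (Literature.MathematicalPhysics.KineticTheory.PointProcess.windowLaw Λ G A))) →
      specificRelEntropy μ G ≤ ENNReal.ofReal (σ ^ 3 *
        liminf (fun k => ((N (ι k) + 1 : ℕ) : ℝ)⁻¹ *
          (InformationTheory.klDiv (Q (ι k))
            (localGibbsLaw σ (fun _ => a) (fun _ => u₀) (fun _ => θ) (N (ι k)) (Φ (ι k)))).toReal) atTop)

/-- **The affinity reduction**: the general weighted bound from the unit-weight bound, the two Kallenberg facts
(tightness of the uniformly averaged and of the complementarily weighted blow-ups; Laplace-functional uniqueness to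
identify `μ¹ = (∫φ) μ^φ + (1 - ∫φ) ν`), and the lower half of affinity `(∫φ) h(μ^φ | G) ≤ h(μ¹ | G)`. -/
theorem stub_tangentEntropyBoundLocalOfUniform :
    HardCoreLawsVaguelyCompact → LaplaceFunctionalDeterminesLaw → TangentEntropyBoundUniform → TangentEntropyBoundLocal := by
  intro hK1 hK2 hU
  have hT : TangentTightness := stub_tangentTightnessOfFacts hK1 hK2
  obtain ⟨σ₂, hσ₂, hU⟩ := hU
  refine ⟨σ₂, hσ₂, ?_⟩
  intro σ a θ u₀ κ hσ hσlt ha hθ hκ φ hφ hφ0 hφ1 hφi N Φ Q hfam ι μ hμ hμP hμT G hGP hGT hGloc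
  haveI : IsProbabilityMeasure (volume : Measure T3) := by rw [volume_pi]; infer_instance
  haveI hQP : ∀ k, IsProbabilityMeasure (Q k) := hfam.2.1
  -- the weight `t = ∫φ ∈ (0, 1]`
  set t : ℝ := ∫ x, φ x with ht
  have ht0 : 0 < t := hφi
  have hφint : Integrable φ (volume : Measure T3) :=
    hφ.integrable_of_hasCompactSupport (HasCompactSupport.of_compactSpace φ)
  have ht1 : t ≤ 1 := by
    have h := integral_mono hφint (integrable_const (1 : ℝ)) hφ1
    rwa [integral_const, probReal_univ, one_smul] at h
  -- the entropy sequence `u k ∈ [0, κ]`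
  set uu : ℕ → ℝ := fun k => ((N (ι k) + 1 : ℕ) : ℝ)⁻¹ *
      (InformationTheory.klDiv (Q (ι k))
        (localGibbsLaw σ (fun _ => a) (fun _ => u₀) (fun _ => θ) (N (ι k)) (Φ (ι k)))).toReal with huu
  have hu0 : ∀ k, 0 ≤ uu k := fun k => mul_nonneg (inv_nonneg.2 (Nat.cast_nonneg _)) ENNReal.toReal_nonneg
  have huκ : ∀ k, uu k ≤ κ := by
    intro k
    have hKL := hfam.2.2.1 (ι k)
    have h1 : (InformationTheory.klDiv (Q (ι k))
        (localGibbsLaw σ (fun _ => a) (fun _ => u₀) (fun _ => θ) (N (ι k)) (Φ (ι k)))).toReal ≤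
        κ * (N (ι k) + 1) := by
      have h := ENNReal.toReal_mono ENNReal.ofReal_ne_top hKL
      rwa [ENNReal.toReal_ofReal (by positivity)] at h
    have hn : (0 : ℝ) < ((N (ι k) + 1 : ℕ) : ℝ) := by positivity
    rw [huu]
    simp only
    rw [inv_mul_le_iff₀ hn]
    calc _ ≤ κ * (N (ι k) + 1) := h1
      _ = ((N (ι k) + 1 : ℕ) : ℝ) * κ := by push_cast; ring
  -- Step A: a subsequence realising the liminf
  obtain ⟨r₀, hr₀, hr₀lim⟩ := exists_strictMono_tendsto_liminf hu0 huκ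
  -- Step B/C: a uniform-weight tangent state along `ι ∘ r₀ ∘ ι₁`
  have hι : StrictMono ι := hμ.1
  have hfam₁ := isTangentFamily_reindex hfam (hι.comp hr₀)
  obtain ⟨ι₁, μ₁, hμ₁P, hμ₁T, hμ₁⟩ := hT σ a θ u₀ κ hσ ha hθ hκ (fun _ => (1 : ℝ)) continuous_const
    (fun _ => zero_le_one) (fun _ => le_rfl) (by rw [integral_const, probReal_univ, one_smul]; exact one_pos)
    _ _ _ hfam₁
  have hι₁ : StrictMono ι₁ := hμ₁.1
  -- Step E: the decomposition `L_{μ₁} = t L_μ + (1 - t) L_ν` along a further subsequence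
  have key : ∃ (s : ℕ → ℕ) (ν : Measure (PointConfig (V3 × V3))), StrictMono s ∧ IsProbabilityMeasure ν ∧
      (∀ f : V3 × V3 → ℝ, Continuous f → HasCompactSupport f → (∀ p, 0 ≤ f p) →
        Tendsto (fun k => tangentLaplace σ (fun _ => (1 : ℝ)) (N (ι (r₀ (s k)))) (Q (ι (r₀ (s k)))) f) atTop
          (𝓝 (laplaceFunctional μ₁ f))) ∧
      ∀ f : V3 × V3 → ℝ, Continuous f → HasCompactSupport f → (∀ p, 0 ≤ f p) →
        laplaceFunctional μ₁ f = t * laplaceFunctional μ f + (1 - t) * laplaceFunctional ν f := by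
    rcases lt_or_eq_of_le ht1 with htlt | hteq
    · -- `t < 1`: a tangent state of the complementary weight `1 - φ`
      set ψ : T3 → ℝ := fun x => 1 - φ x with hψ
      have hψc : Continuous ψ := continuous_const.sub hφ
      have hψ0 : ∀ x, 0 ≤ ψ x := fun x => sub_nonneg.2 (hφ1 x)
      have hψ1 : ∀ x, ψ x ≤ 1 := fun x => show 1 - φ x ≤ 1 by linarith [hφ0 x]
      have hψi : ∫ x, ψ x = 1 - t := by
        show ∫ x, (1 - φ x) = 1 - t
        rw [integral_sub (integrable_const 1) hφint, integral_const, probReal_univ, one_smul]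
      have hψpos : 0 < ∫ x, ψ x := by rw [hψi]; linarith
      have hfam₂ := isTangentFamily_reindex hfam₁ hι₁
      obtain ⟨ι₂, ν, hνP, -, hν⟩ := hT σ a θ u₀ κ hσ ha hθ hκ ψ hψc hψ0 hψ1 hψpos _ _ _ hfam₂
      refine ⟨fun k => ι₁ (ι₂ k), ν, hι₁.comp hν.1, hνP,
        fun f hf hfc hf0 => (hμ₁.2 f hf hfc hf0).comp hν.1.tendsto_atTop, ?_⟩
      intro f hf hfc hf0
      have hA : Tendsto (fun k => tangentLaplace σ (fun _ => (1 : ℝ)) (N (ι (r₀ (ι₁ (ι₂ k)))))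
          (Q (ι (r₀ (ι₁ (ι₂ k))))) f) atTop (𝓝 (laplaceFunctional μ₁ f)) :=
        (hμ₁.2 f hf hfc hf0).comp hν.1.tendsto_atTop
      have hB : Tendsto (fun k => tangentLaplace σ φ (N (ι (r₀ (ι₁ (ι₂ k))))) (Q (ι (r₀ (ι₁ (ι₂ k))))) f) atTop
          (𝓝 (laplaceFunctional μ f)) :=
        (hμ.2 f hf hfc hf0).comp ((hr₀.comp (hι₁.comp hν.1)).tendsto_atTop)
      have hC : Tendsto (fun k => tangentLaplace σ ψ (N (ι (r₀ (ι₁ (ι₂ k))))) (Q (ι (r₀ (ι₁ (ι₂ k))))) f) atTop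
          (𝓝 (laplaceFunctional ν f)) :=
        hν.2 f hf hfc hf0
      have hid : ∀ k, tangentLaplace σ (fun _ => (1 : ℝ)) (N (ι (r₀ (ι₁ (ι₂ k))))) (Q (ι (r₀ (ι₁ (ι₂ k))))) f =
          t * tangentLaplace σ φ (N (ι (r₀ (ι₁ (ι₂ k))))) (Q (ι (r₀ (ι₁ (ι₂ k))))) f +
            (1 - t) * tangentLaplace σ ψ (N (ι (r₀ (ι₁ (ι₂ k))))) (Q (ι (r₀ (ι₁ (ι₂ k))))) f := by
        intro k
        rw [tangentLaplace_one_eq_add hφ ht0.ne' _ _ hf.measurable hf0, ← hψi,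
          integral_mul_tangentLaplace hψpos.ne']
      have hlim : Tendsto (fun k => tangentLaplace σ (fun _ => (1 : ℝ)) (N (ι (r₀ (ι₁ (ι₂ k)))))
          (Q (ι (r₀ (ι₁ (ι₂ k))))) f) atTop (𝓝 (t * laplaceFunctional μ f + (1 - t) * laplaceFunctional ν f)) :=
        ((hB.const_mul t).add (hC.const_mul (1 - t))).congr fun k => (hid k).symm
      exact tendsto_nhds_unique hA hlim
    · -- `t = 1`: `μ₁ = μ`
      refine ⟨ι₁, μ₁, hι₁, hμ₁P, fun f hf hfc hf0 => hμ₁.2 f hf hfc hf0, ?_⟩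
      intro f hf hfc hf0
      have hA : Tendsto (fun k => tangentLaplace σ (fun _ => (1 : ℝ)) (N (ι (r₀ (ι₁ k)))) (Q (ι (r₀ (ι₁ k)))) f)
          atTop (𝓝 (laplaceFunctional μ₁ f)) := hμ₁.2 f hf hfc hf0
      have hB : Tendsto (fun k => tangentLaplace σ φ (N (ι (r₀ (ι₁ k)))) (Q (ι (r₀ (ι₁ k)))) f) atTop
          (𝓝 (laplaceFunctional μ f)) :=
        (hμ.2 f hf hfc hf0).comp ((hr₀.comp hι₁).tendsto_atTop)
      have hid : ∀ k, tangentLaplace σ (fun _ => (1 : ℝ)) (N (ι (r₀ (ι₁ k)))) (Q (ι (r₀ (ι₁ k)))) f =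
          tangentLaplace σ φ (N (ι (r₀ (ι₁ k)))) (Q (ι (r₀ (ι₁ k)))) f := by
        intro k
        obtain ⟨-, hI01⟩ := integrable_innerLaplace σ (N (ι (r₀ (ι₁ k)))) (Q (ι (r₀ (ι₁ k)))) hf.measurable hf0
        have hnn : 0 ≤ ∫ x, (1 - φ x) * ∫ z, Real.exp (-(∑ i, f (blowUpPoint (hsDiameter σ (N (ι (r₀ (ι₁ k))))) x (z i)))) ∂(Q (ι (r₀ (ι₁ k)))) :=
          integral_nonneg fun x => mul_nonneg (sub_nonneg.2 (hφ1 x)) (hI01 x).1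
        have hle : ∫ x, (1 - φ x) * ∫ z, Real.exp (-(∑ i, f (blowUpPoint (hsDiameter σ (N (ι (r₀ (ι₁ k))))) x (z i)))) ∂(Q (ι (r₀ (ι₁ k)))) ≤
            ∫ x, (1 - φ x) :=
          integral_mono_of_nonneg (ae_of_all _ fun x => mul_nonneg (sub_nonneg.2 (hφ1 x)) (hI01 x).1)
            ((integrable_const 1).sub hφint)
            (ae_of_all _ fun x => mul_le_of_le_one_right (sub_nonneg.2 (hφ1 x)) (hI01 x).2)
        have h0 : ∫ x, (1 - φ x) = 0 := by
          rw [integral_sub (integrable_const 1) hφint, integral_const, probReal_univ, one_smul, ← ht, hteq, sub_self]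
        have hz : ∫ x, (1 - φ x) * ∫ z, Real.exp (-(∑ i, f (blowUpPoint (hsDiameter σ (N (ι (r₀ (ι₁ k))))) x (z i)))) ∂(Q (ι (r₀ (ι₁ k)))) = 0 := by
          linarith
        rw [tangentLaplace_one_eq_add hφ ht0.ne' _ _ hf.measurable hf0, hz, add_zero, ← ht, hteq, one_mul]
      have h1 : laplaceFunctional μ₁ f = laplaceFunctional μ f :=
        tendsto_nhds_unique hA (hB.congr fun k => (hid k).symm)
      rw [h1, hteq]
      ring
  obtain ⟨s, ν, hs, hνP, hμ₁s, hdec⟩ := key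
  -- identify `μ₁ = t μ + (1 - t) ν` by Laplace-functional uniqueness
  have hμ₁eq : μ₁ = t.toNNReal • μ + (1 - t).toNNReal • ν := by
    haveI := hμ₁P; haveI := hμP; haveI := hνP
    refine hK2 (V3 × V3) fun f hf hfc hf0 => ?_
    rw [hdec f hf hfc hf0, laplaceFunctional_smul_add μ ν _ _ hf.measurable hfc hf0, Real.coe_toNNReal _ ht0.le,
      Real.coe_toNNReal _ (sub_nonneg.2 ht1)]
  -- Step D: the uniform bound along `ι₃ = ι ∘ r₀ ∘ s`
  have hι₃ : StrictMono fun k => ι (r₀ (s k)) := hι.comp (hr₀.comp hs)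
  have hstate : IsTangentState σ (fun _ => (1 : ℝ)) N Q (fun k => ι (r₀ (s k))) μ₁ := ⟨hι₃, hμ₁s⟩
  have hloc₃ : ∀ Λ : Set V3, MeasurableSet Λ → Bornology.IsBounded Λ → ∀ A : Set (PointConfig (V3 × V3)),
      MeasurableSet A →
      Tendsto (fun k => windowLaw Λ (((volume : Measure T3).prod (localGibbsLaw σ (fun _ => a) (fun _ => u₀)
        (fun _ => θ) (N (ι (r₀ (s k)))) (Φ (ι (r₀ (s k)))))).map
          (fun p => blowUp (hsDiameter σ (N (ι (r₀ (s k))))) p.1 p.2)) A) atTop (𝓝 (windowLaw Λ G A)) :=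
    fun Λ hΛ hΛb A hA => (hGloc Λ hΛ hΛb A hA).comp ((hr₀.comp hs).tendsto_atTop)
  have hbound := hU σ a θ u₀ κ hσ hσlt ha hθ hκ N Φ Q hfam (fun k => ι (r₀ (s k))) μ₁ hstate hμ₁P hμ₁T G hGP hGT
    hloc₃
  have hlim₃ : liminf (fun k => uu (r₀ (s k))) atTop = liminf uu atTop := (hr₀lim.comp hs.tendsto_atTop).liminf_eq
  have hbound' : specificRelEntropy μ₁ G ≤ ENNReal.ofReal (σ ^ 3 * liminf uu atTop) := by
    rw [← hlim₃]; exact hbound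
  -- Step F: affinity; Step G: divide by `t`
  haveI := hμP; haveI := hνP; haveI := hGP
  have haff := stub_specificRelEntropyMixture μ ν G ht0.le ht1
  rw [← hμ₁eq] at haff
  have hfin : specificRelEntropy μ G * ENNReal.ofReal t ≤ ENNReal.ofReal (σ ^ 3 * liminf uu atTop) := by
    rw [mul_comm]; exact haff.trans hbound'
  have htne : ENNReal.ofReal t ≠ 0 := (ENNReal.ofReal_pos.2 ht0).ne'
  have hdiv : specificRelEntropy μ G ≤ ENNReal.ofReal (σ ^ 3 * liminf uu atTop) / ENNReal.ofReal t :=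
    (ENNReal.le_div_iff_mul_le (Or.inl htne) (Or.inl ENNReal.ofReal_ne_top)).2 hfin
  refine hdiv.trans_eq ?_
  rw [← ENNReal.ofReal_div_of_pos ht0]
  congr 1
  rw [ht]
  field_simp
end Summit.AtomisticToContinuum.HydrodynamicLimit.Theorems.KiferCompactification

end
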